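import Mathlib
import Summits.ValiantsHypothesis.ValiantsHypothesis.Theorems.RigidityForcesSymmetryRankRigidMinimalReprLaplaceFiveSeparatedCaptureCommonLineBinary

/-!
# ValiantsHypothesis / RigidityForcesSymmetry — crux `LaplaceOptimalFive` (stmt-ValiantsHypothesis-24813), symmetric capture:
# ★★ **TWO BINARY PAIRS THROUGH A ZERO-DIAGONAL COMMON LINE ARE ONE BINARY NET** ⇒ `finrank W ≤ 5` (the bookkeeping that feeds ✓CLB)

Brick 3 (part 9) of the K1 lane (val-port-2 g6, 2026-08-29).  If two of the three pairwise sums `⟨u,a⟩ ⊔ ⟨u,b⟩`, `⟨u,a⟩ ⊔ ⟨u,c⟩`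
have prolongation of finrank ≥ 4, then by ✓BN (`exists_rows_le_two_of_finrank_prolong`) the rows of all their matrices lie in a
plane of row vectors; that plane contains the two rows `u_i, u_j` of an entry `u_{ij} ≠ 0` of the zero-diagonal `u`, which are
independent, so it IS `P = ⟨u_i, u_j⟩` for both sums.  The symmetric matrices with all rows in `P` form the 3-space
`⟨u_i ⊗ u_i, u_j ⊗ u_j, u_i ⊗ u_j + u_j ⊗ u_i⟩`, which contains the three planes and inherits prolongation ≥ 4, so
✓ `captureIneqSym_of_common_line_binary` gives `finrank W ≤ 5`.  Together with ✓ `finrank_le_six_of_common_line_rows` (some pair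
of prolongation ≤ 3) and ✓ `finrank_prolong_le_four`, this closes `CaptureIneqSym` for EVERY zero-diagonal common line with at
least three nonzero rows (assembly in the next file).

* ★★ `finrank_le_five_of_common_line_two_binary_pairs` — the bookkeeping + ✓CLB.
  The assembly «(SC) for three symmetric 2-planes through a zero-diagonal line with three nonzero rows» (case split on the two
  prolongation finranks, ✓ `finrank_le_six_of_common_line_rows` in the other branches) follows in the next file of the series; after it
  the common-line OPEN list of record is the PAIR-MONOMIAL line `u = x_i x_j` only (located: `W ≤ 5 + r`, (R1); census 62 776/0
  covered by the six typed leaves).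

Honest framing.  `CaptureIneqSym` for three arbitrary planes through a pair-monomial line, `CaptureIneqSym` in general, K1 on
`K₃ ⊔ K₂`, `LaplaceOptimalFive` (OPEN · CONTESTED 72/120), `RankRigidMinimalRepr` and `VP ≠ VNP` are NOT proved here.  No definitions,
no `sorry`.
-/

set_option linter.dupNamespace false
set_option autoImplicit false

namespace Summit.ValiantsHypothesis.ValiantsHypothesis.Theorems.RigidityForcesSymmetryRankRigidMinimalRepr

namespace LaplaceFiveSeparatedCapture

open Finset

/-- ★★ **TWO BINARY PAIRS ⇒ ONE BINARY NET ⇒ `finrank W ≤ 5`.**  `u` symmetric zero-diagonal with `u_{ij} ≠ 0`; `a, b, c` symmetric,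
`a ∉ ⟨u,b⟩`; the sums `⟨u,a⟩ ⊔ ⟨u,b⟩` and `⟨u,a⟩ ⊔ ⟨u,c⟩` have prolongations of finrank ≥ 4.  Then every `W` captured by
`L3 ⟨u,a⟩ ⟨u,b⟩ ⟨u,c⟩` has `finrank W ≤ 5`. [folklore] -/
theorem finrank_le_five_of_common_line_two_binary_pairs (u a b c : Fin 5 → Fin 5 → ℂ) (hu : ∀ p q, u p q = u q p)
    (ha : ∀ p q, a p q = a q p) (hb : ∀ p q, b p q = b q p) (hc : ∀ p q, c p q = c q p)
    (i j : Fin 5) (huij : u i j ≠ 0) (hud : ∀ q, u q q = 0)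
    (hab : a ∉ Submodule.span ℂ ({u, b} : Set (Fin 5 → Fin 5 → ℂ)))
    (h12 : 4 ≤ Module.finrank ℂ (prolong (Submodule.span ℂ ({u, a} : Set (Fin 5 → Fin 5 → ℂ)) ⊔
      Submodule.span ℂ ({u, b} : Set (Fin 5 → Fin 5 → ℂ)))))
    (h13 : 4 ≤ Module.finrank ℂ (prolong (Submodule.span ℂ ({u, a} : Set (Fin 5 → Fin 5 → ℂ)) ⊔
      Submodule.span ℂ ({u, c} : Set (Fin 5 → Fin 5 → ℂ)))))
    (W : Submodule ℂ (Fin 5 → Fin 5 → ℂ))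
    (hWs : ∀ μ ∈ W, ∀ s t : Fin 5, μ s t = μ t s) (hWd : ∀ μ ∈ W, ∀ s : Fin 5, μ s s = 0)
    (hWc : ∀ μ ∈ W, contractZ μ ∈ L3 (Submodule.span ℂ ({u, a} : Set (Fin 5 → Fin 5 → ℂ)))
      (Submodule.span ℂ ({u, b} : Set (Fin 5 → Fin 5 → ℂ))) (Submodule.span ℂ ({u, c} : Set (Fin 5 → Fin 5 → ℂ)))) :
    Module.finrank ℂ W ≤ 5 := by
  classical
  have huji : u j i ≠ 0 := by rwa [hu j i]
  -- symmetric pair spans and their sums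
  have hsym2 : ∀ v : Fin 5 → Fin 5 → ℂ, (∀ p q, v p q = v q p) →
      ∀ x ∈ Submodule.span ℂ ({u, v} : Set (Fin 5 → Fin 5 → ℂ)), ∀ p q : Fin 5, x p q = x q p := by
    intro v hv x hx p q
    obtain ⟨c1, c2, rfl⟩ := Submodule.mem_span_pair.mp hx
    simp only [Pi.add_apply, Pi.smul_apply, smul_eq_mul, hu p q, hv p q]
  have hsupS : ∀ v : Fin 5 → Fin 5 → ℂ, (∀ p q, v p q = v q p) →
      ∀ x ∈ Submodule.span ℂ ({u, a} : Set (Fin 5 → Fin 5 → ℂ)) ⊔ Submodule.span ℂ ({u, v} : Set (Fin 5 → Fin 5 → ℂ)),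
        ∀ p q : Fin 5, x p q = x q p := by
    intro v hv x hx p q
    obtain ⟨y, hy, z, hz, rfl⟩ := Submodule.mem_sup.mp hx
    show y p q + z p q = y q p + z q p
    rw [hsym2 a ha y hy p q, hsym2 v hv z hz p q]
  have hsup3 : ∀ v : Fin 5 → Fin 5 → ℂ, Module.finrank ℂ ↥(Submodule.span ℂ ({u, a} : Set (Fin 5 → Fin 5 → ℂ)) ⊔
      Submodule.span ℂ ({u, v} : Set (Fin 5 → Fin 5 → ℂ))) ≤ 3 := by
    intro v
    have hle : Submodule.span ℂ ({u, a} : Set (Fin 5 → Fin 5 → ℂ)) ⊔ Submodule.span ℂ ({u, v} : Set (Fin 5 → Fin 5 → ℂ)) ≤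
        Submodule.span ℂ ({a} : Set (Fin 5 → Fin 5 → ℂ)) ⊔ Submodule.span ℂ ({u, v} : Set (Fin 5 → Fin 5 → ℂ)) := by
      refine sup_le ?_ le_sup_right
      rw [Submodule.span_le]
      intro x hx
      rcases hx with rfl | rfl
      · exact Submodule.mem_sup_right (Submodule.subset_span (by simp))
      · exact Submodule.mem_sup_left (Submodule.subset_span rfl)
    refine (Submodule.finrank_mono hle).trans ((Submodule.finrank_add_le_finrank_add_finrank _ _).trans ?_)
    have h1 : Module.finrank ℂ (Submodule.span ℂ ({a} : Set (Fin 5 → Fin 5 → ℂ))) ≤ 1 := by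
      have h1' : Module.finrank ℂ (Submodule.span ℂ (↑({a} : Finset (Fin 5 → Fin 5 → ℂ)) : Set (Fin 5 → Fin 5 → ℂ))) ≤ 1 :=
        (finrank_span_finset_le_card _).trans (Finset.card_singleton a).le
      have hset : (↑({a} : Finset (Fin 5 → Fin 5 → ℂ)) : Set (Fin 5 → Fin 5 → ℂ)) = {a} := Finset.coe_singleton a
      rw [hset] at h1'
      exact h1'
    have h2 : Module.finrank ℂ (Submodule.span ℂ ({u, v} : Set (Fin 5 → Fin 5 → ℂ))) ≤ 2 := by
      have h : Module.finrank ℂ (Submodule.span ℂ (↑({u, v} : Finset (Fin 5 → Fin 5 → ℂ)) : Set (Fin 5 → Fin 5 → ℂ))) ≤ 2 :=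
        (finrank_span_finset_le_card _).trans Finset.card_le_two
      have hset : (↑({u, v} : Finset (Fin 5 → Fin 5 → ℂ)) : Set (Fin 5 → Fin 5 → ℂ)) = {u, v} := by
        simp only [Finset.coe_insert, Finset.coe_singleton]
      rw [hset] at h
      exact h
    omega
  -- the plane of row vectors `P = ⟨u_i, u_j⟩`
  let P : Submodule ℂ (Fin 5 → ℂ) := Submodule.span ℂ (Set.range ![u i, u j])
  have hPind : LinearIndependent ℂ ![u i, u j] := by
    rw [LinearIndependent.pair_iff]
    intro s t hst
    have ej := congrFun hst j
    have ei := congrFun hst i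
    simp only [Pi.add_apply, Pi.smul_apply, smul_eq_mul, Pi.zero_apply, hud j, hud i, mul_zero, add_zero, zero_add] at ej ei
    constructor
    · rcases mul_eq_zero.mp ej with h | h
      · exact h
      · exact absurd h huij
    · rcases mul_eq_zero.mp ei with h | h
      · exact h
      · exact absurd h huji
  have hP2 : Module.finrank ℂ P = 2 := by
    have h := finrank_span_eq_card hPind
    simpa using h
  have hrange : Set.range ![u i, u j] = ({u i, u j} : Set (Fin 5 → ℂ)) := by
    ext v
    simp only [Set.mem_range, Set.mem_insert_iff, Set.mem_singleton_iff]
    constructor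
    · rintro ⟨k, rfl⟩
      fin_cases k <;> simp
    · rintro (rfl | rfl)
      exacts [⟨0, by simp⟩, ⟨1, by simp⟩]
  have hPpair : ∀ y ∈ P, ∃ α β : ℂ, α • u i + β • u j = y := fun y hy => by
    have hy' : y ∈ Submodule.span ℂ ({u i, u j} : Set (Fin 5 → ℂ)) := by rw [← hrange]; exact hy
    exact Submodule.mem_span_pair.mp hy'
  -- BN on both sums: their row spaces are `P`
  have hrowsP : ∀ v : Fin 5 → Fin 5 → ℂ, (∀ p q, v p q = v q p) →
      4 ≤ Module.finrank ℂ (prolong (Submodule.span ℂ ({u, a} : Set (Fin 5 → Fin 5 → ℂ)) ⊔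
        Submodule.span ℂ ({u, v} : Set (Fin 5 → Fin 5 → ℂ)))) →
      ∀ x ∈ Submodule.span ℂ ({u, a} : Set (Fin 5 → Fin 5 → ℂ)) ⊔ Submodule.span ℂ ({u, v} : Set (Fin 5 → Fin 5 → ℂ)),
        ∀ q : Fin 5, x q ∈ P := by
    intro v hv h4 x hx q
    obtain ⟨p₀, hL, hrows⟩ := exists_rows_le_two_of_finrank_prolong _ (hsupS v hv) (hsup3 v) h4
    have huX : u ∈ Submodule.span ℂ ({u, a} : Set (Fin 5 → Fin 5 → ℂ)) ⊔ Submodule.span ℂ ({u, v} : Set (Fin 5 → Fin 5 → ℂ)) :=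
      Submodule.mem_sup_left (Submodule.subset_span (by simp))
    have hPL : P ≤ rowIm (Submodule.span ℂ ({u, a} : Set (Fin 5 → Fin 5 → ℂ)) ⊔
        Submodule.span ℂ ({u, v} : Set (Fin 5 → Fin 5 → ℂ))) p₀ := by
      rw [Submodule.span_le]
      rintro y ⟨k, rfl⟩
      fin_cases k
      · exact hrows u huX i
      · exact hrows u huX j
    have hPeq := Submodule.eq_of_le_of_finrank_le hPL (hL.trans hP2.ge)
    rw [hPeq]
    exact hrows x hx q
  -- the binary net `X` of symmetric matrices with rows in `P`
  let X : Submodule ℂ (Fin 5 → Fin 5 → ℂ) :=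
    { carrier := {x | (∀ p q : Fin 5, x p q = x q p) ∧ ∀ q : Fin 5, x q ∈ P}
      add_mem' := fun {x y} hx hy => ⟨fun p q => by simp only [Pi.add_apply, hx.1 p q, hy.1 p q],
        fun q => by rw [Pi.add_apply]; exact P.add_mem (hx.2 q) (hy.2 q)⟩
      zero_mem' := ⟨fun p q => rfl, fun q => by rw [Pi.zero_apply]; exact P.zero_mem⟩
      smul_mem' := fun r x hx => ⟨fun p q => by simp only [Pi.smul_apply, hx.1 p q],
        fun q => by rw [Pi.smul_apply]; exact P.smul_mem r (hx.2 q)⟩ }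
  have hXmem : ∀ x : Fin 5 → Fin 5 → ℂ, x ∈ X ↔ (∀ p q : Fin 5, x p q = x q p) ∧ ∀ q : Fin 5, x q ∈ P := fun x => Iff.rfl
  have hXs : ∀ x ∈ X, ∀ p q : Fin 5, x p q = x q p := fun x hx => ((hXmem x).mp hx).1
  have hX12 : Submodule.span ℂ ({u, a} : Set (Fin 5 → Fin 5 → ℂ)) ⊔ Submodule.span ℂ ({u, b} : Set (Fin 5 → Fin 5 → ℂ)) ≤ X :=
    fun x hx => (hXmem x).mpr ⟨hsupS b hb x hx, hrowsP b hb h12 x hx⟩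
  have hX13 : Submodule.span ℂ ({u, a} : Set (Fin 5 → Fin 5 → ℂ)) ⊔ Submodule.span ℂ ({u, c} : Set (Fin 5 → Fin 5 → ℂ)) ≤ X :=
    fun x hx => (hXmem x).mpr ⟨hsupS c hc x hx, hrowsP c hc h13 x hx⟩
  have hX1 : Submodule.span ℂ ({u, a} : Set (Fin 5 → Fin 5 → ℂ)) ≤ X := le_sup_left.trans hX12
  have hX2 : Submodule.span ℂ ({u, b} : Set (Fin 5 → Fin 5 → ℂ)) ≤ X := le_sup_right.trans hX12
  have hX3 : Submodule.span ℂ ({u, c} : Set (Fin 5 → Fin 5 → ℂ)) ≤ X := le_sup_right.trans hX13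
  -- `X ≤ ⟨u_i ⊗ u_i, u_j ⊗ u_j, u_i ⊗ u_j + u_j ⊗ u_i⟩`, so `finrank X ≤ 3`
  let E1 : Fin 5 → Fin 5 → ℂ := fun q r => u i q * u i r
  let E2 : Fin 5 → Fin 5 → ℂ := fun q r => u j q * u j r
  let E3 : Fin 5 → Fin 5 → ℂ := fun q r => u i q * u j r + u j q * u i r
  have hXle : X ≤ Submodule.span ℂ (↑({E1, E2, E3} : Finset (Fin 5 → Fin 5 → ℂ)) : Set (Fin 5 → Fin 5 → ℂ)) := by
    intro x hx
    obtain ⟨hxs, hxr⟩ := (hXmem x).mp hx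
    choose α β hαβ using fun q => hPpair (x q) (hxr q)
    have hco : ∀ q r, x q r = α q * u i r + β q * u j r := fun q r => by
      have e := congrFun (hαβ q) r
      simp only [Pi.add_apply, Pi.smul_apply, smul_eq_mul] at e
      exact e.symm
    have eβ : ∀ q, β q * u i j = α i * u i q + β i * u j q := fun q => by
      have e := hxs q i
      rw [hco q i, hco i q, hud i, mul_zero, zero_add, hu j i] at e
      linear_combination e
    have eα : ∀ q, α q * u i j = α j * u i q + β j * u j q := fun q => by
      have e := hxs q j
      rw [hco q j, hco j q, hud j, mul_zero, add_zero] at e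
      linear_combination e
    have eij : β j = α i := by
      have e := hxs i j
      rw [hco i j, hco j i, hud i, hud j, mul_zero, mul_zero, add_zero, zero_add, hu j i] at e
      rcases mul_eq_zero.mp (show (α i - β j) * u i j = 0 by linear_combination e) with h | h
      · linear_combination -h
      · exact absurd h huij
    have hxE : x = (u i j)⁻¹ • (α j • E1 + β i • E2 + α i • E3) := by
      funext q r
      simp only [Pi.smul_apply, Pi.add_apply, smul_eq_mul, E1, E2, E3]
      rw [hco q r]
      field_simp
      linear_combination u i r * eα q + u j r * eβ q + u j q * u i r * eij
    rw [hxE]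
    refine Submodule.smul_mem _ _ (Submodule.add_mem _ (Submodule.add_mem _ ?_ ?_) ?_)
    · exact Submodule.smul_mem _ _ (Submodule.subset_span (by simp))
    · exact Submodule.smul_mem _ _ (Submodule.subset_span (by simp))
    · exact Submodule.smul_mem _ _ (Submodule.subset_span (by simp))
  have hX : Module.finrank ℂ X ≤ 3 :=
    ((Submodule.finrank_mono hXle).trans (finrank_span_finset_le_card _)).trans Finset.card_le_three
  have hp4 : 4 ≤ Module.finrank ℂ (prolong X) := h12.trans (Submodule.finrank_mono (prolong_mono hX12))
  exact captureIneqSym_of_common_line_binary u a hu ha _ _ X W hXs hX1 hX2 hX3 hX hp4 hab hWs hWd hWc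

end LaplaceFiveSeparatedCapture

end Summit.ValiantsHypothesis.ValiantsHypothesis.Theorems.RigidityForcesSymmetryRankRigidMinimalRepr
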